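import Summits.QuantumFields.YangMills.Theorems.BalabanUVNodesPortS1ChartJacobian
import Summits.QuantumFields.YangMills.Theorems.BalabanUVNodesN08HaarCompatibilityGuardChartTransfer
import Mathlib.MeasureTheory.Function.AEEqOfLIntegral

/-!
# NODE O port PT-A — FE-1's chart law (T1), brick (B-d′) GENERIC HALF of `Lines/pta_residueW-STAR-FLAT-CHECK-v1.md` §6 (ii-a): ON `SU(2)`, A FORWARD JACOBIAN DENSITY IS IDENTIFIED IN PAULI
# CHARTS BY UNIQUENESS — for ANY one-variable map `F` injective on a window `Ω` with `dU⌊F(Ω) = F_*(jac · dU⌊Ω)`, and any local `C¹` chart read `F ∘ chartAt u₀ = chartAt v₀ ∘ q` on an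
# open `N ⊆ B_π` with `chartAt u₀ (N) ⊆ Ω` and `jac ∘ chartAt u₀` continuous on `N`: `jac(chartAt u₀ x) · chartJac x = chartJac (q x) · |det Dq(x)|` for EVERY `x ∈ N` ([I] (2.10) p.267: the
# Jacobian of «the variables V′(b₀(c)) … eliminated by the δ-functions» read in the coordinates `V = exp(iB′)V^{(k)}` of (2.4))

Cell `ym-nodeO-ideate`, porter seat PT-A-1 (gen 14); `--kind proof --supports stmt-QuantumFields-27930 --as helper`; count-neutral.  [I] = [Balaban1987RG1]; [16] = [Balaban1985UV3].
Docket ★★★ director-ym №678 (2)(ii).  Over ✓`…PortS1ChartJacobian` (`chartAt`, `chartJac`, `haar_map_mul_right`, `measurableSet_image_chartAt`), lit ✓`B10Eq18SigmaSU2Haar`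
(`sigmaMeasure`, `haarProbability_restrict_image_expPauli`), Mathlib's Euclidean change of variables `lintegral_image_eq_lintegral_abs_det_fderiv_mul`, `ae_eq_of_forall_setLIntegral_eq_of_sigmaFinite₀`
and `Measure.eqOn_open_of_ae_eq`.

WHY (STAR-FLAT-CHECK-v1 §1 (C4), §5).  N11's blind sharp bundle (✓`…PortS1ChartOffCentral`) carries its per-bond density `jd = (jac′ ∘ ϑ)⁻¹` behind an `∃`, characterised only by the FORWARD
LAW of `jac′` on the central α-window, its continuity there and injectivity of the one-bond map.  The solved-form chart law ★ needs `jd` IN DEF-1's COORDINATES.  This file proves the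
coordinate formula for ANY density so characterised — by uniqueness: the forward law restricted to a small chart window (injectivity on `Ω`), the Euclidean change of variables for the chart
read `q`, «same push-forward under an injective map ⟹ same measure» ⟹ the two densities agree `dA`-a.e. on the open window ⟹ everywhere on it by continuity (Lebesgue is positive on opens).
No `σ₀` survives (both Haar measures are read in charts with the same density `σ₀·chartJac`) — the constant reconciled in STAR-FLAT-CHECK-v1 §1–§2.

WHAT IS PROVED (0 `def`, 0 `sorry`; `G := SU(2)` as `Matrix.specialUnitaryGroup (Fin 2) ℂ`, `E := ℝ³` as `EuclideanSpace ℝ (Fin 3)`).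
§1 chart windows of ARBITRARY measurable shape `S ⊆ B_π` (✓`…ChartJacobian` had balls; dag-n08's ✓`restrict_image_chart`∕✓`sigmaMeasure_apply_of_subset` BY NAME): `map_chartAt_sigmaMeasure`,
  `haar_restrict_chartAt_image_of_subset`, `haar_chartAt_image_eq_sigmaMeasure`,
  `setLIntegral_haar_chartAt_image_of_subset` (`∫_{chartAt u (S)} G dU = ∫_S σ(|A|)·G(chartAt u A) dA`).
§2 `withDensity_restrict_map_apply_image_of_injOn` («an injective-on-`Ω` push-forward of a measure living on `Ω` gives `F(S)` the mass of `S`»).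
§3 ★★ `jac_mul_chartJac_eq_of_forwardLaw` (the identification on the open chart window, displayed above) · ★★ `jac_mul_chartJac_eq_abs_det_of_apply_eq_zero` (at a solved point `q x⋆ = 0`:
  `jac(chartAt u₀ x⋆) · chartJac x⋆ = |det Dq(x⋆)|`) · ★ `inv_jac_eq_chartJac_div_abs_det` (the `jd`-form: `jac ≠ 0 ⟹ det Dq(x⋆) ≠ 0 ∧ (jac(chartAt u₀ x⋆))⁻¹ = chartJac x⋆ ∕ |det Dq(x⋆)|`).

HONEST FRAMING.  Pure measure theory on `SU(2)` (Haar in exponential coordinates + the Euclidean change of variables + a.e.-uniqueness of densities); the record instantiation ((ii-b): `F` =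
the one-bond average of record, `q = su2Coord ∘ Q̃_c`) and the assembly ★ ((iii)) are NOT here; nothing of Bałaban's (2.10)–(2.14) estimates asserted, ported or discharged; `FEChartLawReg`∕
`FEPolymerActivitiesReg`∕`P0HolExtAtRecordGL`∕`ClassP2Reg`∕`RegSelSmoothOnClass`∕`RegClassNestsUc` inhabited NOWHERE; ⟨27930⟩ OPEN 2∕7 · no claim; NODE O 0∕1; COUNT 8∕28 · K 1∕4 · legs 0∕6
UNMOVED; finite `𝕋⁴_{L^K}` at fixed ε — NOT continuum ∕ OS; **the Yang–Mills mass gap (Clay) is NOT proved by any of this.**  No `sorry`, no `def`, no `instance`; standard axioms only.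
-/

noncomputable section

open MeasureTheory MeasureTheory.Measure Set Metric Function Filter Topology
open scoped ENNReal NNReal BigOperators

namespace Summit.QuantumFields.YangMills.Theorems.BalabanUVNodesPortS1

open Literature.MathematicalPhysics.QuantumFieldTheory (haarProbability)
open Literature.MathematicalPhysics.QuantumFieldTheory.Balaban1983to89
open Literature.MathematicalPhysics.QuantumFieldTheory.Balaban1983to89.B10Eq22Rescaling (sigmaSU2 sigmaSU2_zero)
open Literature.MathematicalPhysics.QuantumFieldTheory.Balaban1983to89.B10Eq18SigmaSU2Haar
open Summit.QuantumFields.YangMills.BalabanUVNodes.N08HaarCompatibilityGuardChartTransfer (restrict_image_chart sigmaMeasure_apply_of_subset)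

/-! ## §1  Haar measure on Pauli chart windows of arbitrary measurable shape -/

section Chart

/-- The translated Pauli chart pushes print's `σ(A)dA` to normalised Haar measure: `(chartAt u)_* σdA = dU` (lit ✓`map_expPauli_sigmaMeasure` + right-invariance ✓`haar_map_mul_right`).
[cite: Balaban1985UV3, (18) p.260] [cite: Balaban1987RG1, (2.4) p.266] -/
theorem map_chartAt_sigmaMeasure (u : Matrix.specialUnitaryGroup (Fin 2) ℂ) :
    sigmaMeasure.map (chartAt u) = haarProbability (Matrix.specialUnitaryGroup (Fin 2) ℂ) := by
  have hm : Measurable fun g : Matrix.specialUnitaryGroup (Fin 2) ℂ => g * u := measurable_id.mul_const u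
  rw [chartAt_eq_comp, ← Measure.map_map hm measurable_expPauli, map_expPauli_sigmaMeasure, haar_map_mul_right]

/-- ★ **HAAR ON A TRANSLATED CHART WINDOW OF ANY MEASURABLE SHAPE**: for `u ∈ SU(2)` and measurable `S ⊆ B_π`, `dU⌊(chartAt u '' S) = (chartAt u)_*(σ(|A|)dA⌊S)` — ✓`haar_restrict_chartAt_image`
with the ball replaced by `S` (dag-n08's ✓`restrict_image_chart` at the chart `chartAt u`). [cite: Balaban1985UV3, (18) p.260] [cite: Balaban1987RG1, (2.4) p.266, (2.10) p.267] -/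
theorem haar_restrict_chartAt_image_of_subset (u : Matrix.specialUnitaryGroup (Fin 2) ℂ) {S : Set (EuclideanSpace ℝ (Fin 3))} (hS : MeasurableSet S)
    (hSπ : S ⊆ ball (0 : EuclideanSpace ℝ (Fin 3)) Real.pi) :
    (haarProbability (Matrix.specialUnitaryGroup (Fin 2) ℂ)).restrict (chartAt u '' S) = (sigmaMeasure.restrict S).map (chartAt u) :=
  restrict_image_chart (continuous_chartAt u) (injOn_chartAt u) (map_chartAt_sigmaMeasure u) hS hSπ

/-- `σdA⌊S = (dA⌊S)·σ(|A|)` for measurable `S ⊆ B_π`. [cite: Balaban1985UV3, (18) p.260] -/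
theorem sigmaMeasure_restrict_of_subset {S : Set (EuclideanSpace ℝ (Fin 3))} (hS : MeasurableSet S) (hSπ : S ⊆ ball (0 : EuclideanSpace ℝ (Fin 3)) Real.pi) :
    sigmaMeasure.restrict S = (volume.restrict S).withDensity fun A => ENNReal.ofReal (sigmaSU2 ‖A‖) := by
  rw [sigmaMeasure, restrict_withDensity hS, Measure.restrict_restrict hS, inter_eq_left.2 hSπ]

/-- ★ **THE HAAR MASS OF A TRANSLATED CHART WINDOW OF ANY SHAPE**: `dU(chartAt u '' S) = σdA(S)` for measurable `S ⊆ B_π`. [cite: Balaban1985UV3, (18) p.260] [cite: Balaban1987RG1, (2.10) p.267] -/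
theorem haar_chartAt_image_eq_sigmaMeasure (u : Matrix.specialUnitaryGroup (Fin 2) ℂ) {S : Set (EuclideanSpace ℝ (Fin 3))} (hS : MeasurableSet S)
    (hSπ : S ⊆ ball (0 : EuclideanSpace ℝ (Fin 3)) Real.pi) :
    haarProbability (Matrix.specialUnitaryGroup (Fin 2) ℂ) (chartAt u '' S) = sigmaMeasure S := by
  have h := congrArg (fun ν : Measure (Matrix.specialUnitaryGroup (Fin 2) ℂ) => ν univ) (haar_restrict_chartAt_image_of_subset u hS hSπ)
  simp only [Measure.restrict_apply_univ, Measure.map_apply (measurable_chartAt u) MeasurableSet.univ, preimage_univ] at h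
  exact h

/-- ★ **«dU = σ(A)dA» ON A TRANSLATED WINDOW OF ANY SHAPE, EVERY MEASURABLE INTEGRAND**: `∫_{chartAt u '' S} G dU = ∫_S σ(|A|)·G(chartAt u A) dA` for measurable `S ⊆ B_π`, measurable `G ≥ 0`.
[cite: Balaban1985UV3, (18) p.260] [cite: Balaban1987RG1, (2.4) p.266, (2.10) p.267] -/
theorem setLIntegral_haar_chartAt_image_of_subset (u : Matrix.specialUnitaryGroup (Fin 2) ℂ) {S : Set (EuclideanSpace ℝ (Fin 3))} (hS : MeasurableSet S)
    (hSπ : S ⊆ ball (0 : EuclideanSpace ℝ (Fin 3)) Real.pi) (G : Matrix.specialUnitaryGroup (Fin 2) ℂ → ℝ≥0∞) (hG : Measurable G) :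
    ∫⁻ g in chartAt u '' S, G g ∂(haarProbability (Matrix.specialUnitaryGroup (Fin 2) ℂ)) =
      ∫⁻ A in S, ENNReal.ofReal (sigmaSU2 ‖A‖) * G (chartAt u A) := by
  rw [haar_restrict_chartAt_image_of_subset u hS hSπ, lintegral_map hG (measurable_chartAt u), sigmaMeasure_restrict_of_subset hS hSπ,
    lintegral_withDensity_eq_lintegral_mul_non_measurable _ measurable_sigmaSU2_norm.ennreal_ofReal (Eventually.of_forall fun _ => ENNReal.ofReal_lt_top) _]
  rfl

end Chart

/-! ## §2  An injective-on-`Ω` push-forward of a measure living on `Ω` gives `F(S)` the mass of `S` -/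

section Inj

variable {α β : Type*} [MeasurableSpace α] [MeasurableSpace β]

/-- ★ For `ν := (μ⌊Ω)·f`, `F` measurable and injective on `Ω`, `S ⊆ Ω` with `F(S)` measurable: `(F_*ν)(F(S)) = ∫_S f dμ` — «no mass outside `S` is mapped into `F(S)`». [folklore] -/
theorem withDensity_restrict_map_apply_image_of_injOn {μ : Measure α} {Ω S : Set α} {F : α → β} (hF : Measurable F) (hinj : InjOn F Ω) (hSΩ : S ⊆ Ω)
    (hFS : MeasurableSet (F '' S)) (f : α → ℝ≥0∞) :
    (((μ.restrict Ω).withDensity f).map F) (F '' S) = ∫⁻ x in S, f x ∂μ := by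
  rw [Measure.map_apply hF hFS, withDensity_apply _ (hF hFS), Measure.restrict_restrict (hF hFS), hinj.preimage_image_inter hSΩ]

end Inj

/-! ## §3  The identification of a forward Jacobian density in Pauli charts -/

section Ident

/-- ★★ **A FORWARD JACOBIAN DENSITY ON `SU(2)` IS IDENTIFIED IN PAULI CHARTS, BY UNIQUENESS.**  Let `F : SU(2) → SU(2)` be measurable and injective on a measurable `Ω`, with the forward law
`dU⌊F(Ω) = F_*(jac·dU⌊Ω)` for a measurable `jac ≥ 0`.  Let `N ⊆ B_π` be open with `chartAt u₀ (N) ⊆ Ω`, and `q : ℝ³ → ℝ³` injective on `N` with values in `B_π`, derivative `q′` (continuous on `N`),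
and `F(chartAt u₀ x) = chartAt v₀ (q x)` on `N` (so `q` is injective on `N`); assume `jac ∘ chartAt u₀` is continuous on `N`.  THEN `jac(chartAt u₀ x) · chartJac x = chartJac (q x) · |det q′(x)|` for EVERY `x ∈ N`.
(Forward law ⌊ chart window, by injectivity on `Ω`; Euclidean change of variables for `q`; both sides give `F(chartAt u₀ A)` the same Haar mass for every measurable `A ⊆ N` ⟹ densities equal
`dA⌊N`-a.e. ⟹ equal on the open `N` by continuity.) [cite: Balaban1987RG1, (2.10) p.267, p.268] [cite: Balaban1985UV3, (16) p.259, (18) p.260] -/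
theorem jac_mul_chartJac_eq_of_forwardLaw {Ω : Set (Matrix.specialUnitaryGroup (Fin 2) ℂ)} {F : Matrix.specialUnitaryGroup (Fin 2) ℂ → Matrix.specialUnitaryGroup (Fin 2) ℂ}
    (hF : Measurable F) (hinj : InjOn F Ω) {jac : Matrix.specialUnitaryGroup (Fin 2) ℂ → ℝ≥0} (hjm : Measurable jac)
    (hfwd : (haarProbability (Matrix.specialUnitaryGroup (Fin 2) ℂ)).restrict (F '' Ω) =
      (((haarProbability (Matrix.specialUnitaryGroup (Fin 2) ℂ)).restrict Ω).withDensity fun g => (jac g : ℝ≥0∞)).map F)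
    {u₀ v₀ : Matrix.specialUnitaryGroup (Fin 2) ℂ} {N : Set (EuclideanSpace ℝ (Fin 3))} (hNo : IsOpen N) (hNπ : N ⊆ ball (0 : EuclideanSpace ℝ (Fin 3)) Real.pi)
    (hNΩ : MapsTo (chartAt u₀) N Ω) {q : EuclideanSpace ℝ (Fin 3) → EuclideanSpace ℝ (Fin 3)}
    {q' : EuclideanSpace ℝ (Fin 3) → EuclideanSpace ℝ (Fin 3) →L[ℝ] EuclideanSpace ℝ (Fin 3)}
    (hq : ∀ x ∈ N, HasFDerivAt q (q' x) x) (hq'c : ContinuousOn q' N) (hqπ : MapsTo q N (ball (0 : EuclideanSpace ℝ (Fin 3)) Real.pi))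
    (hFq : ∀ x ∈ N, F (chartAt u₀ x) = chartAt v₀ (q x)) (hjc : ContinuousOn (fun x => (jac (chartAt u₀ x) : ℝ)) N) :
    ∀ x ∈ N, (jac (chartAt u₀ x) : ℝ) * chartJac x = chartJac (q x) * |(q' x).det| := by
  have hσ0 : 0 < sigmaSU2 0 := by rw [sigmaSU2_zero]; positivity
  have hqc : ContinuousOn q N := fun x hx => (hq x hx).continuousAt.continuousWithinAt
  -- `q` is injective on `N`: `chartAt v₀ ∘ q = F ∘ chartAt u₀` there, `F` injective on `Ω ⊇ chartAt u₀ (N)`, the charts injective on `B_π`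
  have hqi : InjOn q N := by
    intro x hx x' hx' h
    have h1 : F (chartAt u₀ x) = F (chartAt u₀ x') := by rw [hFq x hx, hFq x' hx', h]
    exact injOn_chartAt u₀ (hNπ hx) (hNπ hx') (hinj (hNΩ hx) (hNΩ hx') h1)
  -- the two densities on `N`, in `ℝ≥0∞`
  set f₁ : EuclideanSpace ℝ (Fin 3) → ℝ≥0∞ := fun x => ENNReal.ofReal (sigmaSU2 ‖x‖) * (jac (chartAt u₀ x) : ℝ≥0∞) with hf₁
  set f₂ : EuclideanSpace ℝ (Fin 3) → ℝ≥0∞ := fun x => ENNReal.ofReal |(q' x).det| * ENNReal.ofReal (sigmaSU2 ‖q x‖) with hf₂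
  have hjm' : Measurable fun g => (jac g : ℝ≥0∞) := measurable_coe_nnreal_ennreal.comp hjm
  have hf₁m : Measurable f₁ := measurable_sigmaSU2_norm.ennreal_ofReal.mul (hjm'.comp (measurable_chartAt u₀))
  have hf₂m : AEMeasurable f₂ (volume.restrict N) := by
    have ha : ContinuousOn (fun x => ENNReal.ofReal |(q' x).det|) N :=
      ENNReal.continuous_ofReal.comp_continuousOn (continuous_abs.comp_continuousOn (ContinuousLinearMap.continuous_det.comp_continuousOn hq'c))
    have hb : ContinuousOn (fun x => ENNReal.ofReal (sigmaSU2 ‖q x‖)) N :=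
      ENNReal.continuous_ofReal.comp_continuousOn (continuous_sigmaSU2_norm.comp_continuousOn hqc)
    exact (ha.aemeasurable hNo.measurableSet).mul (hb.aemeasurable hNo.measurableSet)
  -- both give `F(chartAt u₀ A)` the same Haar mass, for every measurable `A ⊆ N`
  have hkey : ∀ A : Set (EuclideanSpace ℝ (Fin 3)), MeasurableSet A → A ⊆ N → ∫⁻ x in A, f₁ x = ∫⁻ x in A, f₂ x := by
    intro A hA hAN
    simp only [hf₁, hf₂]
    have hAπ : A ⊆ ball (0 : EuclideanSpace ℝ (Fin 3)) Real.pi := hAN.trans hNπ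
    have hAΩ : chartAt u₀ '' A ⊆ Ω := fun g ⟨x, hx, hgx⟩ => hgx ▸ hNΩ (hAN hx)
    have hcA : MeasurableSet (chartAt u₀ '' A) := measurableSet_image_chartAt u₀ hA hAπ
    have hqA : MeasurableSet (q '' A) := hA.image_of_continuousOn_injOn (hqc.mono hAN) (hqi.mono hAN)
    have hqAπ : q '' A ⊆ ball (0 : EuclideanSpace ℝ (Fin 3)) Real.pi := fun y ⟨x, hx, hyx⟩ => hyx ▸ hqπ (hAN hx)
    have himg : F '' (chartAt u₀ '' A) = chartAt v₀ '' (q '' A) := by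
      rw [image_image, image_image]
      exact image_congr fun x hx => hFq x (hAN hx)
    have hFA : MeasurableSet (F '' (chartAt u₀ '' A)) := by rw [himg]; exact measurableSet_image_chartAt v₀ hqA hqAπ
    -- side 1: through the forward law
    have h1 : ∫⁻ x in A, ENNReal.ofReal (sigmaSU2 ‖x‖) * (jac (chartAt u₀ x) : ℝ≥0∞) = haarProbability (Matrix.specialUnitaryGroup (Fin 2) ℂ) (F '' (chartAt u₀ '' A)) := by
      rw [← setLIntegral_haar_chartAt_image_of_subset u₀ hA hAπ (fun g => (jac g : ℝ≥0∞)) hjm',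
        ← withDensity_restrict_map_apply_image_of_injOn hF hinj hAΩ hFA, ← hfwd, Measure.restrict_apply hFA,
        inter_eq_left.2 (image_mono (image_subset_iff.2 fun x hx => hNΩ (hAN hx)))]
    -- side 2: through the Euclidean change of variables for `q`
    have h2 : ∫⁻ x in A, ENNReal.ofReal |(q' x).det| * ENNReal.ofReal (sigmaSU2 ‖q x‖) = haarProbability (Matrix.specialUnitaryGroup (Fin 2) ℂ) (F '' (chartAt u₀ '' A)) := by
      rw [← lintegral_image_eq_lintegral_abs_det_fderiv_mul volume hA (fun x hx => (hq x (hAN hx)).hasFDerivWithinAt) (hqi.mono hAN)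
        (fun y => ENNReal.ofReal (sigmaSU2 ‖y‖)), ← sigmaMeasure_apply_of_subset hqA hqAπ, ← haar_chartAt_image_eq_sigmaMeasure v₀ hqA hqAπ, himg]
    rw [h1, h2]
  -- hence the densities agree `dA⌊N`-a.e.
  have hae : f₁ =ᵐ[volume.restrict N] f₂ := by
    refine ae_eq_of_forall_setLIntegral_eq_of_sigmaFinite₀ hf₁m.aemeasurable hf₂m fun s hs _ => ?_
    simp only [Measure.restrict_restrict hs]
    exact hkey (s ∩ N) (hs.inter hNo.measurableSet) inter_subset_right
  -- real form, a.e.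
  have hae' : (fun x => (jac (chartAt u₀ x) : ℝ) * chartJac x) =ᵐ[volume.restrict N] fun x => chartJac (q x) * |(q' x).det| := by
    filter_upwards [hae] with x hx
    have h1 : f₁ x = ENNReal.ofReal (sigmaSU2 0 * ((jac (chartAt u₀ x) : ℝ) * chartJac x)) := by
      rw [hf₁]; dsimp only
      rw [ofReal_sigmaSU2_eq, ← ENNReal.ofReal_coe_nnreal, ← ENNReal.ofReal_mul hσ0.le, ← ENNReal.ofReal_mul (mul_nonneg hσ0.le (chartJac_nonneg x))]
      ring_nf
    have h2 : f₂ x = ENNReal.ofReal (sigmaSU2 0 * (chartJac (q x) * |(q' x).det|)) := by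
      rw [hf₂]; dsimp only
      rw [ofReal_sigmaSU2_eq, ← ENNReal.ofReal_mul hσ0.le, ← ENNReal.ofReal_mul (abs_nonneg _)]
      ring_nf
    rw [h1, h2] at hx
    have hx' := (ENNReal.ofReal_eq_ofReal_iff (mul_nonneg hσ0.le (mul_nonneg (NNReal.coe_nonneg _) (chartJac_nonneg x)))
      (mul_nonneg hσ0.le (mul_nonneg (chartJac_nonneg _) (abs_nonneg _)))).1 hx
    exact mul_left_cancel₀ hσ0.ne' hx'
  -- both sides continuous on the open `N` ⟹ equal on `N`
  have hc1 : ContinuousOn (fun x => (jac (chartAt u₀ x) : ℝ) * chartJac x) N := hjc.mul continuous_chartJac.continuousOn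
  have hc2 : ContinuousOn (fun x => chartJac (q x) * |(q' x).det|) N :=
    (continuous_chartJac.comp_continuousOn hqc).mul (continuous_abs.comp_continuousOn (ContinuousLinearMap.continuous_det.comp_continuousOn hq'c))
  exact Measure.eqOn_open_of_ae_eq hae' hNo hc1 hc2

/-- ★★ **AT A SOLVED POINT** (`q x⋆ = 0`, i.e. `F(chartAt u₀ x⋆) = v₀`): `jac(chartAt u₀ x⋆) · chartJac x⋆ = |det q′(x⋆)|` (`chartJac 0 = 1`). [cite: Balaban1987RG1, (2.10) p.267, p.268] -/
theorem jac_mul_chartJac_eq_abs_det_of_apply_eq_zero {Ω : Set (Matrix.specialUnitaryGroup (Fin 2) ℂ)} {F : Matrix.specialUnitaryGroup (Fin 2) ℂ → Matrix.specialUnitaryGroup (Fin 2) ℂ}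
    (hF : Measurable F) (hinj : InjOn F Ω) {jac : Matrix.specialUnitaryGroup (Fin 2) ℂ → ℝ≥0} (hjm : Measurable jac)
    (hfwd : (haarProbability (Matrix.specialUnitaryGroup (Fin 2) ℂ)).restrict (F '' Ω) =
      (((haarProbability (Matrix.specialUnitaryGroup (Fin 2) ℂ)).restrict Ω).withDensity fun g => (jac g : ℝ≥0∞)).map F)
    {u₀ v₀ : Matrix.specialUnitaryGroup (Fin 2) ℂ} {N : Set (EuclideanSpace ℝ (Fin 3))} (hNo : IsOpen N) (hNπ : N ⊆ ball (0 : EuclideanSpace ℝ (Fin 3)) Real.pi)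
    (hNΩ : MapsTo (chartAt u₀) N Ω) {q : EuclideanSpace ℝ (Fin 3) → EuclideanSpace ℝ (Fin 3)}
    {q' : EuclideanSpace ℝ (Fin 3) → EuclideanSpace ℝ (Fin 3) →L[ℝ] EuclideanSpace ℝ (Fin 3)}
    (hq : ∀ x ∈ N, HasFDerivAt q (q' x) x) (hq'c : ContinuousOn q' N) (hqπ : MapsTo q N (ball (0 : EuclideanSpace ℝ (Fin 3)) Real.pi))
    (hFq : ∀ x ∈ N, F (chartAt u₀ x) = chartAt v₀ (q x)) (hjc : ContinuousOn (fun x => (jac (chartAt u₀ x) : ℝ)) N)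
    {xs : EuclideanSpace ℝ (Fin 3)} (hxs : xs ∈ N) (h0 : q xs = 0) :
    (jac (chartAt u₀ xs) : ℝ) * chartJac xs = |(q' xs).det| := by
  have h := jac_mul_chartJac_eq_of_forwardLaw hF hinj hjm hfwd hNo hNπ hNΩ hq hq'c hqπ hFq hjc xs hxs
  rwa [h0, chartJac_zero, one_mul] at h

/-- ★ **THE `jd`-FORM AT A SOLVED POINT**: if moreover `jac(chartAt u₀ x⋆) ≠ 0` (N11's clause `hjac0` on the window) then `det q′(x⋆) ≠ 0` and `(jac(chartAt u₀ x⋆))⁻¹ = chartJac x⋆ ∕ |det q′(x⋆)|`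
— N11's `jd = (jac′ ∘ ϑ)⁻¹` in DEF-1's coordinates, NO `σ₀` (STAR-FLAT-CHECK-v1 §1 (C4)). [cite: Balaban1987RG1, (2.10) p.267, p.268] -/
theorem inv_jac_eq_chartJac_div_abs_det {Ω : Set (Matrix.specialUnitaryGroup (Fin 2) ℂ)} {F : Matrix.specialUnitaryGroup (Fin 2) ℂ → Matrix.specialUnitaryGroup (Fin 2) ℂ}
    (hF : Measurable F) (hinj : InjOn F Ω) {jac : Matrix.specialUnitaryGroup (Fin 2) ℂ → ℝ≥0} (hjm : Measurable jac)
    (hfwd : (haarProbability (Matrix.specialUnitaryGroup (Fin 2) ℂ)).restrict (F '' Ω) =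
      (((haarProbability (Matrix.specialUnitaryGroup (Fin 2) ℂ)).restrict Ω).withDensity fun g => (jac g : ℝ≥0∞)).map F)
    {u₀ v₀ : Matrix.specialUnitaryGroup (Fin 2) ℂ} {N : Set (EuclideanSpace ℝ (Fin 3))} (hNo : IsOpen N) (hNπ : N ⊆ ball (0 : EuclideanSpace ℝ (Fin 3)) Real.pi)
    (hNΩ : MapsTo (chartAt u₀) N Ω) {q : EuclideanSpace ℝ (Fin 3) → EuclideanSpace ℝ (Fin 3)}
    {q' : EuclideanSpace ℝ (Fin 3) → EuclideanSpace ℝ (Fin 3) →L[ℝ] EuclideanSpace ℝ (Fin 3)}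
    (hq : ∀ x ∈ N, HasFDerivAt q (q' x) x) (hq'c : ContinuousOn q' N) (hqπ : MapsTo q N (ball (0 : EuclideanSpace ℝ (Fin 3)) Real.pi))
    (hFq : ∀ x ∈ N, F (chartAt u₀ x) = chartAt v₀ (q x)) (hjc : ContinuousOn (fun x => (jac (chartAt u₀ x) : ℝ)) N)
    {xs : EuclideanSpace ℝ (Fin 3)} (hxs : xs ∈ N) (h0 : q xs = 0) (hjac0 : jac (chartAt u₀ xs) ≠ 0) :
    (q' xs).det ≠ 0 ∧ ((jac (chartAt u₀ xs) : ℝ))⁻¹ = chartJac xs / |(q' xs).det| := by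
  have h := jac_mul_chartJac_eq_abs_det_of_apply_eq_zero hF hinj hjm hfwd hNo hNπ hNΩ hq hq'c hqπ hFq hjc hxs h0
  have hxπ : ‖xs‖ < Real.pi := by simpa using hNπ hxs
  have hcj : 0 < chartJac xs := by
    rw [chartJac]
    exact div_pos (B10Eq22Rescaling.sigmaSU2_pos (norm_nonneg _) hxπ) (by rw [sigmaSU2_zero]; positivity)
  have hjac : 0 < (jac (chartAt u₀ xs) : ℝ) := lt_of_le_of_ne (NNReal.coe_nonneg _) (fun h0' => hjac0 (NNReal.coe_eq_zero.1 h0'.symm))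
  have hdet' : 0 < |(q' xs).det| := by rw [← h]; exact mul_pos hjac hcj
  refine ⟨abs_pos.1 hdet', ?_⟩
  rw [eq_div_iff hdet'.ne', ← h, ← mul_assoc, inv_mul_cancel₀ hjac.ne', one_mul]

end Ident

end Summit.QuantumFields.YangMills.Theorems.BalabanUVNodesPortS1

end
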